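import Summits.QuantumFields.BalabanUV.T4Continuum.Spine.NE3.FrameNormalisationDefectSize
import HarnessLib

/-!
# T⁴ programme, node NE3 — census R50 open half (M1), ELEVENTH BRICK: the framed product `e^{−S₋}·T·(B e^{S₊} B′)` is Lipschitz in ALL THREE data — exponents AND the middle
# factor `T = Ṽ₁(c)` — the one-step letter for the TOWER DISPLACEMENT `‖D^{j+1} − U̿′^{j+1}‖` (`FrameNormalisationDefectSizeJoint`)

Cell `pub-balaban-gaps` (track G2, seat ne3, generation 11), row NE3; census `HOME/ne/NE3.md` §4 R50, §17 (M1).  `FrameNormalisationDefectSize.norm_framed_sub_framed_le` varies the two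
exponents of the framed product `w(c₋)⁻¹·Ṽ₁(c)·R(V̄₀(c))w(c₊)` at a FIXED middle factor.  Along the twisted tower (`FrameNormalisationTower`) the middle factor moves too:
`Ṽ[Ū₀ʲ, Dʲ](c)` vs `Ṽ[Ū₀ʲ, U̿′ʲ](c)` — the one-step average (42)∕(65) is Lipschitz in the configuration ([Balaban1985Averaging] Prop. 7 p. 43; tree:
`B7Eq65AverageLipschitz.norm_bavg_sub_bavg_le`), which supplies a letter `θ_T`.  This module is the generic three-factor estimate with that letter as a hypothesis:

* `norm_inv_mul_mul_sub_le₃` — `a′⁻¹b′c′ − a⁻¹bc = (a′⁻¹ − a⁻¹)b′c′ + a⁻¹(b′ − b)c′ + a⁻¹b(c′ − c)`, hence the norm bound.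
* **`norm_framed_sub_framed_le₃`** — `‖e^{−S₋}T′(B e^{S₊} B′) − e^{−F₋}T(B e^{F₊} B′)‖ ≤ τβ²Λ(e^{4φ+3Λ} + e^{2φ+Λ}) + θ_T·β²·e^{2φ+Λ}` for `‖S_± − F_±‖ ≤ Λ`, `‖F_±‖ ≤ φ`,
  `‖T‖, ‖T′‖ ≤ τ`, `‖T′ − T‖ ≤ θ_T`, `‖B‖, ‖B′‖ ≤ β` — the one-step letter of the displacement recursion `‖D^{j+1} − U̿′^{j+1}‖ ≤ …` (twist `Λ_j` from bricks 2∕6∕8, middle factor `θ_T`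
  from the average's Lipschitz property at `‖Dʲ − U̿′ʲ‖`).

HONEST FRAMING (page 1).  Elementary Banach-algebra estimates (0 def, 0 sorry); the displacement recursion through the levels and the contraction are NOT done; nothing of Bałaban's
asserted; **NE3 NOT proved**; `PairLandauGaugeB8Avg` and the covariant root NOT proved; spine PROVED 0∕9; finite T⁴ rung (B)+1 — NOT continuum YM on ℝ⁴, NOT infinite volume, NOT
mass gap, NOT `BetaPertH`, NOT Clay.  HONEST DEPENDENCY: continuum YM on T⁴ ⇐ BetaPertH ∧ nine spine estimates (0/9 proved); BetaPertH ⇐ (D1) ∧ (D4) ∧ CAP+tail; G-an2-4 gates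
asym, D1 and NE2/3/4.  PLACEMENT: `Summits/QuantumFields/BalabanUV/T4Continuum/Spine/NE3/`; imports `FrameNormalisationDefectSize` only.

References: [Balaban1985Averaging] T. Bałaban, *Averaging operations for lattice gauge theories*, CMP 98 (1985) 17–51: (42) p. 23, (65) p. 29, (89) p. 31, Prop. 7 p. 43.
-/

set_option autoImplicit false

open scoped BigOperators Matrix Matrix.Norms.L2Operator
open NormedSpace

namespace Summit.QuantumFields.BalabanUV.T4Continuum.NE3.FrameNormalisationDefectSizeJoint

open Literature.MathematicalPhysics.QuantumFieldTheory.Balaban1983to89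
open Literature.Analysis.Complex (norm_exp_le_exp_norm)
open NE3.FrameNormalisationDefectSize (norm_exp_sub_exp_le_of_near norm_exp_le_of_near)

noncomputable section

variable {n : Type*} [Fintype n] [DecidableEq n]

/-- **PERTURBING ALL THREE FACTORS OF `a⁻¹·b·c`**: `a′⁻¹b′c′ − a⁻¹bc = a′⁻¹(a − a′)a⁻¹·b′c′ + a⁻¹(b′ − b)c′ + a⁻¹b(c′ − c)`. [folklore] -/
theorem norm_inv_mul_mul_sub_le₃ {aI aI' a a' b b' c c' : Matrix n n ℂ} (ha : aI * a = 1) (ha' : a' * aI' = 1) :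
    ‖aI' * b' * c' - aI * b * c‖
      ≤ ‖aI'‖ * ‖a - a'‖ * ‖aI‖ * ‖b'‖ * ‖c'‖ + ‖aI‖ * ‖b' - b‖ * ‖c'‖ + ‖aI‖ * ‖b‖ * ‖c' - c‖ := by
  have hid : aI' * b' * c' - aI * b * c = (aI' * (a - a') * aI) * b' * c' + aI * (b' - b) * c' + aI * b * (c' - c) := by
    have h1 : aI' * (a - a') * aI = aI' - aI := by
      rw [mul_sub, sub_mul, mul_assoc aI' a aI]
      have haR : a * aI = 1 := mul_eq_one_comm.mp ha
      have haL : aI' * a' = 1 := mul_eq_one_comm.mp ha'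
      rw [haR, mul_one, haL, one_mul]
    rw [h1]
    noncomm_ring
  rw [hid]
  refine (norm_add_le _ _).trans (add_le_add ((norm_add_le _ _).trans (add_le_add ?_ ?_)) ?_)
  · calc ‖aI' * (a - a') * aI * b' * c'‖ ≤ ‖aI' * (a - a') * aI * b'‖ * ‖c'‖ := norm_mul_le _ _
      _ ≤ ‖aI' * (a - a') * aI‖ * ‖b'‖ * ‖c'‖ := by gcongr; exact norm_mul_le _ _
      _ ≤ ‖aI' * (a - a')‖ * ‖aI‖ * ‖b'‖ * ‖c'‖ := by gcongr; exact norm_mul_le _ _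
      _ ≤ ‖aI'‖ * ‖a - a'‖ * ‖aI‖ * ‖b'‖ * ‖c'‖ := by gcongr; exact norm_mul_le _ _
  · calc ‖aI * (b' - b) * c'‖ ≤ ‖aI * (b' - b)‖ * ‖c'‖ := norm_mul_le _ _
      _ ≤ ‖aI‖ * ‖b' - b‖ * ‖c'‖ := by gcongr; exact norm_mul_le _ _
  · calc ‖aI * b * (c' - c)‖ ≤ ‖aI * b‖ * ‖c' - c‖ := norm_mul_le _ _
      _ ≤ ‖aI‖ * ‖b‖ * ‖c' - c‖ := by gcongr; exact norm_mul_le _ _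

/-- **THE FRAMED PRODUCT IS LIPSCHITZ IN ALL THREE DATA**: `‖e^{−S₋}·T′·(B e^{S₊} B′) − e^{−F₋}·T·(B e^{F₊} B′)‖ ≤ τβ²Λ(e^{4φ+3Λ} + e^{2φ+Λ}) + θ_T·β²·e^{2φ+Λ}`. [folklore] -/
theorem norm_framed_sub_framed_le₃ [Nonempty n] {Fm Fp Sm Sp T T' B BI : Matrix n n ℂ} {Λ φ τ β θT : ℝ} (hτ : 0 ≤ τ) (hβ : 0 ≤ β)
    (hSm : ‖Sm - Fm‖ ≤ Λ) (hSp : ‖Sp - Fp‖ ≤ Λ) (hFm : ‖Fm‖ ≤ φ) (hFp : ‖Fp‖ ≤ φ)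
    (hT : ‖T‖ ≤ τ) (hT' : ‖T'‖ ≤ τ) (hTT : ‖T' - T‖ ≤ θT) (hB : ‖B‖ ≤ β) (hBI : ‖BI‖ ≤ β) :
    ‖exp (-Sm) * T' * (B * exp Sp * BI) - exp (-Fm) * T * (B * exp Fp * BI)‖
      ≤ τ * β ^ 2 * Λ * (Real.exp (4 * φ + 3 * Λ) + Real.exp (2 * φ + Λ)) + θT * β ^ 2 * Real.exp (2 * φ + Λ) := by
  letI : NormedAlgebra ℚ (Matrix n n ℂ) := NormedAlgebra.restrictScalars ℚ ℂ (Matrix n n ℂ)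
  have hΛ : 0 ≤ Λ := (norm_nonneg _).trans hSm
  have hθ : 0 ≤ θT := (norm_nonneg _).trans hTT
  obtain ⟨-, hemI⟩ := norm_exp_le_of_near hSm hFm
  obtain ⟨hep, -⟩ := norm_exp_le_of_near hSp hFp
  have hFmn : ‖-Fm‖ ≤ φ := by rw [norm_neg]; exact hFm
  have heFm : ‖exp (-Fm)‖ ≤ Real.exp φ := (norm_exp_le_exp_norm _).trans (Real.exp_le_exp.mpr hFmn)
  have hdm : ‖exp Fm - exp Sm‖ ≤ Λ * Real.exp (φ + Λ) := by
    rw [norm_sub_rev]; exact norm_exp_sub_exp_le_of_near hSm hFm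
  have hdp : ‖exp Sp - exp Fp‖ ≤ Λ * Real.exp (φ + Λ) := norm_exp_sub_exp_le_of_near hSp hFp
  have hc' : ‖B * exp Sp * BI‖ ≤ β * Real.exp (φ + Λ) * β := by
    calc ‖B * exp Sp * BI‖ ≤ ‖B * exp Sp‖ * ‖BI‖ := norm_mul_le _ _
      _ ≤ ‖B‖ * ‖exp Sp‖ * ‖BI‖ := by gcongr; exact norm_mul_le _ _
      _ ≤ β * Real.exp (φ + Λ) * β := by gcongr
  have hcc : ‖B * exp Sp * BI - B * exp Fp * BI‖ ≤ β * (Λ * Real.exp (φ + Λ)) * β := by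
    have h1 : B * exp Sp * BI - B * exp Fp * BI = B * (exp Sp - exp Fp) * BI := by noncomm_ring
    rw [h1]
    calc ‖B * (exp Sp - exp Fp) * BI‖ ≤ ‖B * (exp Sp - exp Fp)‖ * ‖BI‖ := norm_mul_le _ _
      _ ≤ ‖B‖ * ‖exp Sp - exp Fp‖ * ‖BI‖ := by gcongr; exact norm_mul_le _ _
      _ ≤ β * (Λ * Real.exp (φ + Λ)) * β := by gcongr
  have hinvF : exp (-Fm) * exp Fm = 1 := by
    rw [← exp_add_of_commute (Commute.neg_left (Commute.refl Fm)), neg_add_cancel, exp_zero]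
  have hinvS : exp Sm * exp (-Sm) = 1 := by
    rw [← exp_add_of_commute (Commute.neg_right (Commute.refl Sm)), add_neg_cancel, exp_zero]
  have hmain := norm_inv_mul_mul_sub_le₃ (b := T) (b' := T') (c := B * exp Fp * BI) (c' := B * exp Sp * BI) hinvF hinvS
  refine hmain.trans ?_
  have e1 : ‖exp (-Sm)‖ * ‖exp Fm - exp Sm‖ * ‖exp (-Fm)‖ * ‖T'‖ * ‖B * exp Sp * BI‖
      ≤ Real.exp (φ + Λ) * (Λ * Real.exp (φ + Λ)) * Real.exp φ * τ * (β * Real.exp (φ + Λ) * β) := by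
    gcongr
  have e2 : ‖exp (-Fm)‖ * ‖T' - T‖ * ‖B * exp Sp * BI‖ ≤ Real.exp φ * θT * (β * Real.exp (φ + Λ) * β) := by
    gcongr
  have e3 : ‖exp (-Fm)‖ * ‖T‖ * ‖B * exp Sp * BI - B * exp Fp * BI‖ ≤ Real.exp φ * τ * (β * (Λ * Real.exp (φ + Λ)) * β) := by
    gcongr
  have hexp1 : Real.exp (φ + Λ) * (Λ * Real.exp (φ + Λ)) * Real.exp φ * τ * (β * Real.exp (φ + Λ) * β)
      = τ * β ^ 2 * Λ * Real.exp (4 * φ + 3 * Λ) := by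
    have : Real.exp (4 * φ + 3 * Λ) = Real.exp (φ + Λ) * Real.exp (φ + Λ) * Real.exp φ * Real.exp (φ + Λ) := by
      rw [← Real.exp_add, ← Real.exp_add, ← Real.exp_add]; ring_nf
    rw [this]; ring
  have hexp2 : Real.exp φ * θT * (β * Real.exp (φ + Λ) * β) = θT * β ^ 2 * Real.exp (2 * φ + Λ) := by
    have : Real.exp (2 * φ + Λ) = Real.exp φ * Real.exp (φ + Λ) := by
      rw [← Real.exp_add]; ring_nf
    rw [this]; ring
  have hexp3 : Real.exp φ * τ * (β * (Λ * Real.exp (φ + Λ)) * β) = τ * β ^ 2 * Λ * Real.exp (2 * φ + Λ) := by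
    have : Real.exp (2 * φ + Λ) = Real.exp φ * Real.exp (φ + Λ) := by
      rw [← Real.exp_add]; ring_nf
    rw [this]; ring
  calc _ ≤ Real.exp (φ + Λ) * (Λ * Real.exp (φ + Λ)) * Real.exp φ * τ * (β * Real.exp (φ + Λ) * β)
          + Real.exp φ * θT * (β * Real.exp (φ + Λ) * β)
          + Real.exp φ * τ * (β * (Λ * Real.exp (φ + Λ)) * β) := add_le_add (add_le_add e1 e2) e3
    _ = τ * β ^ 2 * Λ * (Real.exp (4 * φ + 3 * Λ) + Real.exp (2 * φ + Λ)) + θT * β ^ 2 * Real.exp (2 * φ + Λ) := by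
        rw [hexp1, hexp2, hexp3]; ring

end

end Summit.QuantumFields.BalabanUV.T4Continuum.NE3.FrameNormalisationDefectSizeJoint
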